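import Summits.CriticalPhenomena.PercolationContinuityZ3.Theorems.PercNearOneGluingNoHeavyLowerTailCILUnionExchangeAvoidedDominanceOfDiagonal
import Summits.CriticalPhenomena.PercolationContinuityZ3.Theorems.PercNearOneGluingNoHeavyLowerTailCovTauOfTA
import HarnessLib

/-!
# `NoHeavyLowerTail` (stmt-CriticalPhenomena-4575) — DOM2 (Kozma–Nitzan's Theorem 1 with an avoided vertex),
# UNCONDITIONALLY, from the landed `T_A` chain

Support file (`--supports stmt-CriticalPhenomena-4575`), prover `prim-hp-7` (gen 6).  No definitions, no named facts, no
sorries; standard axioms.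

`…CILUnionExchangeAvoidedDominanceOfDiagonal` (prim-gen-induct) derives the event form of COV(τ) and the avoided-vertex union
exchange DOM2 (`UnionExchange.pair_avoided_dominance_of_diagonal`) from the A2-diagonal hypothesis `H`.  Since COV(τ) itself is
now an unconditional tree theorem (`CovTau.covTau`, …CovTauOfTA: COV(τ) ≡ MDL(X), proved through prim-hp-7's `T_A` functional and
Lemma P_v), the same two statements hold with NO hypothesis:

* `UnionExchange.cov_event` — event form of COV(τ): for every upper family `𝒜`,
  `μ(t↮s, t↮a, t↔o) · cov_R(A, {s↔t}) ≤ μ(t↮s, t↮a) · cov_R(A, {s↔o})`, `R = {s↮a}`, `A = {C_s ∈ 𝒜}`;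
* `UnionExchange.pair_avoided_dominance` — DOM2 for the terminals `a₁ ≠ a₂`, the observer `o` and the avoided vertex
  `a ∉ {a₁, a₂}` (`UnionExchange.pair_avoided_dominance_of_cov` fed with `cov_event` twice): the `|W| = 2` avoided-vertex union
  exchange of the crux line (BLOBQUOTIENT §25–28: DOM2 ⟹ UX ⟹ AUT(|W|=2) ⟹ RHLA(|B|=3)).
[cite: KozmaNitzan2024, Thm. 1 (pp. 7–8)] [cite: VandenbergHaggstromKahn2005, Thms. 1.3–1.4 (pp. 6–7), §2.1 (pp. 9–13)]
[cite: Gladkov2024, Thm. 3.2]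
-/

noncomputable section

open MeasureTheory Set
open Literature.Probability.LatticeModels (prodBernoulli)
open Literature.Probability.Percolation Literature.Probability.Percolation.KNPreFKG
open scoped Classical

namespace Summit.CriticalPhenomena.PercolationContinuityZ3.Theorems

namespace UnionExchange

variable {V : Type*} [Fintype V]

/-- **Event form of COV(τ), unconditionally** (owner `s`, avoided vertex `a`, observers `o` and `t ≠ s`): for every upper
family `𝒜`, `μ(t↮s, t↮a, t↔o)·cov_R(A, {s↔t}) ≤ μ(t↮s, t↮a)·cov_R(A, {s↔o})`, `R = {s↮a}`, `A = {C_s ∈ 𝒜}` — `CovTau.covTau`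
at `f = 1_𝒜`. [cite: VandenbergHaggstromKahn2005, Thms. 1.3–1.4 (pp. 6–7), §2.1 (pp. 9–13)] [cite: Gladkov2024, Thm. 3.2] -/
theorem cov_event (w : Sym2 V → unitInterval) (o s t a : V) (hts : t ≠ s)
    {𝒜 : Set (Set (Sym2 V))} (h𝒜 : IsUpperSet 𝒜) :
      (prodBernoulli w).real ({ω : BondConfig V | ¬ (openGraph ω).Reachable t s} ∩
          {ω | ¬ (openGraph ω).Reachable t a} ∩ openConn t o) *
        ((prodBernoulli w).real {ω : BondConfig V | ¬ (openGraph ω).Reachable s a} *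
            (prodBernoulli w).real ({ω : BondConfig V | ¬ (openGraph ω).Reachable s a} ∩ openConn s t ∩
              {ω | openEdgeCluster ω s ∈ 𝒜}) -
          (prodBernoulli w).real ({ω : BondConfig V | ¬ (openGraph ω).Reachable s a} ∩ {ω | openEdgeCluster ω s ∈ 𝒜}) *
            (prodBernoulli w).real ({ω : BondConfig V | ¬ (openGraph ω).Reachable s a} ∩ openConn s t)) ≤
      (prodBernoulli w).real ({ω : BondConfig V | ¬ (openGraph ω).Reachable t s} ∩
          {ω | ¬ (openGraph ω).Reachable t a}) *
        ((prodBernoulli w).real {ω : BondConfig V | ¬ (openGraph ω).Reachable s a} *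
            (prodBernoulli w).real ({ω : BondConfig V | ¬ (openGraph ω).Reachable s a} ∩ openConn s o ∩
              {ω | openEdgeCluster ω s ∈ 𝒜}) -
          (prodBernoulli w).real ({ω : BondConfig V | ¬ (openGraph ω).Reachable s a} ∩ {ω | openEdgeCluster ω s ∈ 𝒜}) *
            (prodBernoulli w).real ({ω : BondConfig V | ¬ (openGraph ω).Reachable s a} ∩ openConn s o)) := by
  have h := CovTau.covTau w s a o t hts (𝒜.indicator 1) (monotone_indicator_one_of_isUpperSet h𝒜)
  rw [indicator_comp_openEdgeCluster] at h
  simp only [setIntegral_indicator_one_eq] at h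
  exact h

/-- **DOM2 (Kozma–Nitzan's Theorem 1 with an avoided vertex), unconditionally**: observer `o`, terminals `a₁ ≠ a₂`, avoided
vertex `a ∉ {a₁, a₂}`; there is ONE `θ ∈ [0,1]` such that for EVERY upper family `𝒜`, with `Oᵢ = {o↔aᵢ}`, `M = {a₁↔a₂}`,
`Rᵢ = {aᵢ↮a}`, `D = {o↮a}`, `Λ₁ = μ(R₁∩O₁∩Mᶜ) + θ μ(R₁∩O₁∩M)`, `Λ₂ = μ(R₂∩O₂∩Mᶜ) + (1−θ) μ(R₂∩O₂∩M)`: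
`Λ₁ μ(R₂) μ(R₁ ∩ {C_{a₁}∈𝒜}) + Λ₂ μ(R₁) μ(R₂ ∩ {C_{a₂}∈𝒜}) ≤ μ(R₁) μ(R₂) μ((O₁∪O₂) ∩ D ∩ {C_o∈𝒜})`.
(`pair_avoided_dominance_of_cov` + `cov_event` at `(a₁, a, o, a₂)` and `(a₂, a, o, a₁)`.) [cite: KozmaNitzan2024, Thm. 1 (pp. 7–8)] -/
theorem pair_avoided_dominance (w : Sym2 V → unitInterval) (o a₁ a₂ a : V) (h12 : a₁ ≠ a₂) (h1a : a₁ ≠ a)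
    (h2a : a₂ ≠ a) :
    ∃ θ : ℝ, 0 ≤ θ ∧ θ ≤ 1 ∧ ∀ 𝒜 : Set (Set (Sym2 V)), IsUpperSet 𝒜 →
      (prodBernoulli w).real {ω : BondConfig V | ¬ (openGraph ω).Reachable a₂ a} *
          ((prodBernoulli w).real ({ω : BondConfig V | ¬ (openGraph ω).Reachable a₁ a} ∩ openConn o a₁ ∩
              {ω | ¬ (openGraph ω).Reachable a₁ a₂}) +
            θ * (prodBernoulli w).real ({ω : BondConfig V | ¬ (openGraph ω).Reachable a₁ a} ∩ openConn o a₁ ∩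
              openConn a₁ a₂)) *
          (prodBernoulli w).real ({ω : BondConfig V | ¬ (openGraph ω).Reachable a₁ a} ∩
            {ω | openEdgeCluster ω a₁ ∈ 𝒜}) +
        (prodBernoulli w).real {ω : BondConfig V | ¬ (openGraph ω).Reachable a₁ a} *
          ((prodBernoulli w).real ({ω : BondConfig V | ¬ (openGraph ω).Reachable a₂ a} ∩ openConn o a₂ ∩
              {ω | ¬ (openGraph ω).Reachable a₁ a₂}) +
            (1 - θ) * (prodBernoulli w).real ({ω : BondConfig V | ¬ (openGraph ω).Reachable a₂ a} ∩
              openConn o a₂ ∩ openConn a₁ a₂)) *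
          (prodBernoulli w).real ({ω : BondConfig V | ¬ (openGraph ω).Reachable a₂ a} ∩
            {ω | openEdgeCluster ω a₂ ∈ 𝒜}) ≤
      (prodBernoulli w).real {ω : BondConfig V | ¬ (openGraph ω).Reachable a₁ a} *
        (prodBernoulli w).real {ω : BondConfig V | ¬ (openGraph ω).Reachable a₂ a} *
        (prodBernoulli w).real ((openConn o a₁ ∪ openConn o a₂) ∩
          {ω : BondConfig V | ¬ (openGraph ω).Reachable o a} ∩ {ω | openEdgeCluster ω o ∈ 𝒜}) :=
  pair_avoided_dominance_of_cov w o a₁ a₂ a h12 h1a h2a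
    (fun _ h𝒜 => cov_event w o a₁ a₂ a h12.symm h𝒜)
    (fun _ h𝒜 => cov_event w o a₂ a₁ a h12 h𝒜)

end UnionExchange

end Summit.CriticalPhenomena.PercolationContinuityZ3.Theorems

end
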